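import Literature.Analysis.Fourier.LpMultiplierSchwartz
import HarnessLib

/-!
# Schwartz symbols are `L^∞` multipliers (the endpoint `p = ∞` of Young's inequality)

`Literature/Analysis/Fourier/LpMultiplierSchwartz.lean` proves that a Schwartz symbol `m`
(acting as `m • 1` on vector-valued functions) is an `Lᵖ` Fourier multiplier with constant
`‖𝓕⁻¹m‖₁` for `1 ≤ p < ∞`, via Minkowski's integral inequality. This file adds the (easier)
endpoint `p = ∞` — `‖k ∗ f‖_∞ ≤ ‖k‖₁ ‖f‖_∞` pointwise — and the combined statement for all
`1 ≤ p ≤ ∞`, which is the range of [BrennerThomeeWahlbin1975, Ch. 5 Lemma 1.1] ("Let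
`1 ≤ p ≤ ∞`, `p ≠ 2` …"; the inputs `χv, w ∈ C₀^∞ ⊂ M_p` of its proof, (1.5)).
[BrennerThomeeWahlbin1975, Ch. 1 Thm 2.3]: `M_∞` consists of the Fourier transforms of bounded
measures, `M_∞(a) = V(μ)`; for `a = m` Schwartz, `μ = 𝓕⁻¹m dx` and `V(μ) = ‖𝓕⁻¹m‖₁`.

## Contents

* `eLpNorm_convolution_smul_le_top` — Young `L¹ × L^∞ → L^∞`;
* `eLpNorm_convolution_smul_le'` — Young `L¹ × Lᵖ → Lᵖ`, all `1 ≤ p ≤ ∞`;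
* `isLpMultiplierWith_smul_one_schwartz'`, `isLpMultiplier_smul_one_schwartz'` — all
  `1 ≤ p ≤ ∞`.

## References

* [BrennerThomeeWahlbin1975] P. Brenner, V. Thomée, L. B. Wahlbin, LNM 434 (1975), Ch. 1
  Thm 2.3 pp. 9–10; Ch. 5 §1 Lemma 1.1, (1.5).
-/

noncomputable section

open MeasureTheory FourierTransform Convolution ContinuousLinearMap
open scoped SchwartzMap ENNReal NNReal

namespace Literature.Analysis.Fourier

variable {V : Type*} [NormedAddCommGroup V] [InnerProductSpace ℝ V] [FiniteDimensional ℝ V]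
  [MeasurableSpace V] [BorelSpace V] {F : Type*} [NormedAddCommGroup F] [NormedSpace ℂ F]
  {ι : Type*} [Fintype ι]

/-- **Young's inequality `L¹ × L^∞ → L^∞`** for `k ∗ f (x) = ∫ k(t) f(x - t) dt`, complex scalar
kernel, vector-valued `f`: `‖k ∗ f‖_∞ ≤ ‖k‖₁ ‖f‖_∞` (pointwise: `‖f(x - t)‖ ≤ ‖f‖_∞` for
a.e. `t`, by translation invariance). [folklore] -/
theorem eLpNorm_convolution_smul_le_top {k : V → ℂ} (hk : AEStronglyMeasurable k volume)
    (f : V → F) :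
    eLpNorm (k ⋆[lsmul ℂ ℂ] f) ∞ volume ≤ (∫⁻ t, ‖k t‖ₑ) * eLpNorm f ∞ volume := by
  rw [eLpNorm_exponent_top, eLpNorm_exponent_top]
  refine eLpNormEssSup_le_of_ae_enorm_bound (Filter.Eventually.of_forall fun x => ?_)
  -- pointwise bound at every `x`
  have hae : ∀ᵐ t ∂(volume : Measure V), ‖f (x - t)‖ₑ ≤ eLpNormEssSup f volume :=
    (Measure.measurePreserving_sub_left volume x).quasiMeasurePreserving.ae
      (enorm_ae_le_eLpNormEssSup f volume)
  calc ‖(k ⋆[lsmul ℂ ℂ] f) x‖ₑ = ‖∫ t, k t • f (x - t)‖ₑ := rfl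
    _ ≤ ∫⁻ t, ‖k t • f (x - t)‖ₑ := enorm_integral_le_lintegral_enorm _
    _ = ∫⁻ t, ‖k t‖ₑ * ‖f (x - t)‖ₑ := by simp_rw [enorm_smul]
    _ ≤ ∫⁻ t, ‖k t‖ₑ * eLpNormEssSup f volume :=
        lintegral_mono_ae (hae.mono fun t ht => mul_le_mul_right ht _)
    _ = (∫⁻ t, ‖k t‖ₑ) * eLpNormEssSup f volume := lintegral_mul_const'' _ hk.enorm

/-- **Young's inequality `L¹ × Lᵖ → Lᵖ`, `1 ≤ p ≤ ∞`** (complex scalar kernel, vector-valued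
`f`): `‖k ∗ f‖_p ≤ ‖k‖₁ ‖f‖_p`. [folklore] -/
theorem eLpNorm_convolution_smul_le' {k : V → ℂ} (hk : AEStronglyMeasurable k volume)
    {f : V → F} (hf : AEStronglyMeasurable f volume) {p : ℝ≥0∞} (hp1 : 1 ≤ p) :
    eLpNorm (k ⋆[lsmul ℂ ℂ] f) p volume ≤ (∫⁻ t, ‖k t‖ₑ) * eLpNorm f p volume := by
  rcases eq_or_ne p ⊤ with rfl | hp
  · exact eLpNorm_convolution_smul_le_top hk f
  · exact eLpNorm_convolution_smul_le hk hf hp1 hp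

/-- **Schwartz symbols are `Lᵖ` multipliers for all `1 ≤ p ≤ ∞`**:
`IsLpMultiplierWith p ‖𝓕⁻¹m‖₁ (m • 1)`. [cite: BrennerThomeeWahlbin1975, Ch. 1 Thms 2.3–2.4] -/
theorem isLpMultiplierWith_smul_one_schwartz' [DecidableEq ι] (m : 𝓢(V, ℂ)) {p : ℝ≥0∞}
    (hp1 : 1 ≤ p) :
    IsLpMultiplierWith p (∫⁻ t, ‖(𝓕⁻ m : 𝓢(V, ℂ)) t‖ₑ).toNNReal
      (fun ξ => m ξ • (1 : Matrix ι ι ℂ)) := by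
  rcases eq_or_ne p ⊤ with rfl | hp
  · have hfin : (∫⁻ t, ‖(𝓕⁻ m : 𝓢(V, ℂ)) t‖ₑ) ≠ ⊤ :=
      (𝓕⁻ m : 𝓢(V, ℂ)).integrable.hasFiniteIntegral.ne
    -- the guard is exponent-independent: take it from the case `p = 1`
    refine ⟨(isLpMultiplierWith_smul_one_schwartz (ι := ι) m le_rfl ENNReal.one_ne_top).1,
      fun f => ?_⟩
    rw [multiplierOp_smul_one_eq_convolution, ENNReal.coe_toNNReal hfin]
    exact eLpNorm_convolution_smul_le_top (𝓕⁻ m : 𝓢(V, ℂ)).continuous.aestronglyMeasurable _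
  · exact isLpMultiplierWith_smul_one_schwartz m hp1 hp

/-- Schwartz symbols are in `M_p` for all `1 ≤ p ≤ ∞`.
[cite: BrennerThomeeWahlbin1975, Ch. 1 Thms 2.3–2.4] -/
theorem isLpMultiplier_smul_one_schwartz' [DecidableEq ι] (m : 𝓢(V, ℂ)) {p : ℝ≥0∞}
    (hp1 : 1 ≤ p) : IsLpMultiplier p (fun ξ => m ξ • (1 : Matrix ι ι ℂ)) :=
  (isLpMultiplierWith_smul_one_schwartz' m hp1).isLpMultiplier

end Literature.Analysis.Fourier

end
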